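import Summits.RiemannHypothesis.RiemannHypothesis.Theorems.WeilTwoPrimeDeflE72Base
import Summits.RiemannHypothesis.RiemannHypothesis.Theorems.WeilTwoPrimeDeflE72DataR
import Literature.NumberTheory.LFunctions.WeilTwoPrimeCellsT120
import Literature.NumberTheory.LFunctions.WeilTwoPrimeCertificateDeflated
import HarnessLib

/-!
# Deflated two-prime certificate E72: the certificate `weilCertDeflE72 : WeilCert23` and its augmented coefficient matrix

`weilCertDeflE72` = base `weilCertDeflE72Base` + `j = 5` + `pnu = 64` + the cells `weilTwoPrimeCellsT120` + support `b = 18/25` + the table `weilCertDeflE72Nu`; penalty data `weilCertDeflE72R`; `weilCertDeflE72P = P_r + Σ μ ĉ ĉᵀ`. [cite: Yoshida1992, §6, Thm 1 p. 310] Data only.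
-/

noncomputable section

namespace Summit.RiemannHypothesis.RiemannHypothesis.Theorems.EvenWinsBeyondArch

open Literature.NumberTheory.LFunctions

/-- **The deflated two-prime certificate E72** (`a₀ = b = 18/25`, `N = 255`, `T = 120`, `β₂₃ = 17/25`, k_even = 6). [folklore] -/
def weilCertDeflE72 : WeilCert23 := ⟨weilCertDeflE72Base, 5, 64, weilTwoPrimeCellsT120, 18/25, weilCertDeflE72Nu⟩

/-- The base of `weilCertDeflE72` is `weilCertDeflE72Base` (definitional). [folklore] -/
theorem weilCertDeflE72_base : weilCertDeflE72.base = weilCertDeflE72Base := rfl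

/-- The table of `weilCertDeflE72` is `weilCertDeflE72Nu` (definitional). [folklore] -/
theorem weilCertDeflE72_nuTab : weilCertDeflE72.nuTab = weilCertDeflE72Nu := rfl

/-- The augmented coefficient matrix `P_r + Σ μ ĉ ĉᵀ` of certificate E72. [folklore] -/
def weilCertDeflE72P (k l : ℕ) : ℚ := weilCertDeflE72Base.prQ weilCertDeflE72Nu k l + rankOneQ weilCertDeflE72R k l

/-- `weilCertDeflE72P` is the augmented matrix of the certificate (definitional). [folklore] -/
theorem weilCertDeflE72P_eq : weilCertDeflE72P = fun k l ↦ weilCertDeflE72.base.prQ weilCertDeflE72.nuTab k l + rankOneQ weilCertDeflE72R k l := rfl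

end Summit.RiemannHypothesis.RiemannHypothesis.Theorems.EvenWinsBeyondArch
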